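import Summits.CriticalPhenomena.CardyFormulaZ2.Theorems.StripClusterRates.Negative.SubmultiplicativeOne
import Summits.CriticalPhenomena.CardyFormulaZ2.Theorems.CardyBoundaryCoulombGasStripClusterRatesStubSandwichUpper

/-!
# Stub `co_cardyOrderOne_of_kacOne` (S2) of line `two-cluster-rate-is-stationary-gap`
# (crux `CardyBoundaryCoulombGas.StripClusterRates`, stmt-CriticalPhenomena-13878)

**S2 · NECESSITY of the Cardy-order one-cluster Kac statement CO₁.** Let
`p₁(m,n) = crossingProb half m n` be the probability of an open left-right crossing of
`[0,m]×[0,n]` (bond percolation on `ℤ²` at `p = 1/2`) and let `γ(n) = lim_m -log p₁(m,n)/m`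
(`n ≥ 1`) be the lengthwise decay rates (the `γ₁`-half of the crux). If `n·γ(n) → π/3`, then there
are `g, G : ℕ → ℝ` with `g(A)/A → π/3`, `G(A)/A → π/3` and, for every aspect `A ≥ 1`, eventually
in the width `n`: `e^{-G(A)} ≤ p₁(A·n, n) ≤ e^{-g(A)}` (CO₁).

Proof. Take `g(A) = (A-1)(π/3 - 1/A) - log 2` and `G(A) = (A+1)(π/3 + 1/A)` (`co1n_tendsto_g`,
`co1n_tendsto_G`: elementary limits). UPPER (`co1n_upper`): for `A ≥ 2` the landed super-multiplicative
sandwich `stub_sandwichUpper` at `m = A·n > n` reads `(A-1)·n·γ(n) ≤ log 2 - log p₁(A n, n)`;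
eventually `n·γ(n) ≥ π/3 - 1/A`, so `log p₁ ≤ -g(A)`; for `A = 1`, `e^{-g(1)} = 2 ≥ 1 ≥ p₁`.
LOWER (`co1n_lower`): the landed sub-multiplicative bound `Negative.rateOne_ge_finite` at `m = A·n`
reads `-log p₁(A n, n) ≤ (A n + 1)·γ(n) ≤ (A+1)·n·γ(n)` (`γ(n) > 0` by `Negative.rateOne_ge`,
`n ≥ 1`); eventually `n·γ(n) ≤ π/3 + 1/A`, so `-log p₁ ≤ G(A)`.
-/

noncomputable section

open MeasureTheory Filter Topology Set
open Literature.Probability.LatticeModels Literature.Probability.Percolation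

namespace Summit.CriticalPhenomena.CardyFormulaZ2.Cruxes.StripClusterRates.TwoClusterRateIsStationaryGap

open Summit.CriticalPhenomena.CardyFormulaZ2.Theorems.StripClusterRates.Negative (pOne pOne_ge
  rateOne_ge_finite rateOne_ge rateSeqOne)

/-! ## Small analytic facts -/

/-- **The lower Cardy-order constant**: `g(A)/A → π/3` for `g(A) = (A-1)(π/3 - 1/A) - log 2`. [folklore] -/
theorem co1n_tendsto_g :
    Tendsto (fun A : ℕ ↦ (((A : ℝ) - 1) * (Real.pi / 3 - 1 / A) - Real.log 2) / A) atTop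
      (𝓝 (Real.pi / 3)) := by
  have h : Tendsto (fun A : ℕ ↦ 1 / (A : ℝ)) atTop (𝓝 0) := tendsto_one_div_atTop_nhds_zero_nat
  have h1 : Tendsto (fun A : ℕ ↦ (1 - 1 / (A : ℝ)) * (Real.pi / 3 - 1 / A) - Real.log 2 * (1 / A))
      atTop (𝓝 ((1 - 0) * (Real.pi / 3 - 0) - Real.log 2 * 0)) :=
    ((tendsto_const_nhds.sub h).mul (tendsto_const_nhds.sub h)).sub (tendsto_const_nhds.mul h)
  rw [sub_zero, sub_zero, one_mul, mul_zero, sub_zero] at h1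
  refine h1.congr' ?_
  filter_upwards [eventually_ge_atTop 1] with A hA
  have hA0 : (A : ℝ) ≠ 0 := Nat.cast_ne_zero.mpr (by omega)
  field_simp

/-- **The upper Cardy-order constant**: `G(A)/A → π/3` for `G(A) = (A+1)(π/3 + 1/A)`. [folklore] -/
theorem co1n_tendsto_G :
    Tendsto (fun A : ℕ ↦ ((A : ℝ) + 1) * (Real.pi / 3 + 1 / A) / A) atTop (𝓝 (Real.pi / 3)) := by
  have h : Tendsto (fun A : ℕ ↦ 1 / (A : ℝ)) atTop (𝓝 0) := tendsto_one_div_atTop_nhds_zero_nat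
  have h1 : Tendsto (fun A : ℕ ↦ (1 + 1 / (A : ℝ)) * (Real.pi / 3 + 1 / A)) atTop
      (𝓝 ((1 + 0) * (Real.pi / 3 + 0))) :=
    (tendsto_const_nhds.add h).mul (tendsto_const_nhds.add h)
  rw [add_zero, add_zero, one_mul] at h1
  refine h1.congr' ?_
  filter_upwards [eventually_ge_atTop 1] with A hA
  have hA0 : (A : ℝ) ≠ 0 := Nat.cast_ne_zero.mpr (by omega)
  field_simp

/-! ## The two finite-width bounds -/

/-- **Lower bound at a fixed width.** If `-log p₁(m,n)/m → γ` (`n ≥ 1`) and `n·γ ≤ π/3 + 1/A`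
(`A ≥ 1`), then `e^{-G(A)} ≤ p₁(A n, n)`: sub-multiplicativity (`rateOne_ge_finite`) gives
`-log p₁(A n, n) ≤ (A n + 1)·γ ≤ (A+1)·n·γ`. [folklore] -/
theorem co1n_lower {A n : ℕ} (hA : 1 ≤ A) (hn : 1 ≤ n) {γ : ℝ}
    (hγ : Tendsto (fun m : ℕ ↦ -Real.log (crossingProb half m n) / (m : ℝ)) atTop (𝓝 γ))
    (hup : (n : ℝ) * γ ≤ Real.pi / 3 + 1 / A) :
    Real.exp (-(((A : ℝ) + 1) * (Real.pi / 3 + 1 / A))) ≤ crossingProb half (A * n) n := by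
  have hp : 0 < crossingProb half (A * n) n := lt_of_lt_of_le (by positivity) (pOne_ge (A * n) n)
  have hfin : -Real.log (crossingProb half (A * n) n) / (((A * n : ℕ) : ℝ) + 1) ≤ γ :=
    rateOne_ge_finite hγ (A * n)
  have hγpos : 0 < γ :=
    lt_of_lt_of_le (div_pos (Real.log_pos one_lt_two) (by positivity)) (rateOne_ge hγ)
  have hden : (0 : ℝ) < ((A * n : ℕ) : ℝ) + 1 := by positivity
  rw [div_le_iff₀ hden] at hfin
  have hAr : (1 : ℝ) ≤ A := by exact_mod_cast hA
  have hnr : (1 : ℝ) ≤ n := by exact_mod_cast hn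
  have hcast : ((A * n : ℕ) : ℝ) + 1 ≤ ((A : ℝ) + 1) * n := by push_cast; nlinarith
  have h1 : γ * (((A * n : ℕ) : ℝ) + 1) ≤ ((A : ℝ) + 1) * ((n : ℝ) * γ) := by nlinarith
  have h2 : ((A : ℝ) + 1) * ((n : ℝ) * γ) ≤ ((A : ℝ) + 1) * (Real.pi / 3 + 1 / A) :=
    mul_le_mul_of_nonneg_left hup (by positivity)
  rw [← Real.exp_log hp]
  exact Real.exp_le_exp.2 (by linarith)

/-- **Upper bound at a fixed width.** If `-log p₁(m,n)/m → γ` (`n ≥ 1`) and `π/3 - 1/A ≤ n·γ`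
(`A ≥ 1`), then `p₁(A n, n) ≤ e^{-g(A)}`: for `A ≥ 2` the super-multiplicative sandwich
(`stub_sandwichUpper` at `m = A n > n`) gives `(A-1)·n·γ ≤ log 2 - log p₁(A n, n)`; for `A = 1`,
`e^{-g(1)} = 2`. [folklore] -/
theorem co1n_upper {A n : ℕ} (hA : 1 ≤ A) (hn : 1 ≤ n) {γ : ℝ}
    (hγ : Tendsto (fun m : ℕ ↦ -Real.log (crossingProb half m n) / (m : ℝ)) atTop (𝓝 γ))
    (hlow : Real.pi / 3 - 1 / A ≤ (n : ℝ) * γ) :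
    crossingProb half (A * n) n ≤ Real.exp (-(((A : ℝ) - 1) * (Real.pi / 3 - 1 / A) - Real.log 2)) := by
  rcases Nat.lt_or_ge A 2 with hA2 | hA2
  · obtain rfl : A = 1 := by omega
    have h : -((((1 : ℕ) : ℝ) - 1) * (Real.pi / 3 - 1 / ((1 : ℕ) : ℝ)) - Real.log 2) = Real.log 2 := by
      push_cast; ring
    rw [h, Real.exp_log two_pos]
    exact (crossingProb_mem_Icc _ _ _).2.trans one_le_two
  · have hp : 0 < crossingProb half (A * n) n := lt_of_lt_of_le (by positivity) (pOne_ge (A * n) n)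
    have hlt : n < A * n := by
      have : 2 * n ≤ A * n := Nat.mul_le_mul_right n hA2
      omega
    have hsw := stub_sandwichUpper n hn γ hγ (A * n) hlt
    have hcast : ((A * n : ℕ) : ℝ) - n = ((A : ℝ) - 1) * n := by push_cast; ring
    have hAr : (2 : ℝ) ≤ A := by exact_mod_cast hA2
    have hnr : (1 : ℝ) ≤ n := by exact_mod_cast hn
    have hden : (0 : ℝ) < ((A : ℝ) - 1) * n := by nlinarith
    rw [hcast, le_div_iff₀ hden] at hsw
    have h1 : ((A : ℝ) - 1) * (Real.pi / 3 - 1 / A) ≤ ((A : ℝ) - 1) * ((n : ℝ) * γ) :=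
      mul_le_mul_of_nonneg_left hlow (by linarith)
    refine (Real.log_le_iff_le_exp hp).1 ?_
    linarith

/-! ## The registered stub -/

/-- **S2 — `co_cardyOrderOne_of_kacOne`.** The `γ₁`-half of the crux (`n·γ(n) → π/3` for the
lengthwise decay rates `γ(n)` of `p₁(m,n) = crossingProb half m n`) IMPLIES the Cardy-order
one-cluster Kac statement CO₁: there are `g, G` with `g(A)/A, G(A)/A → π/3` and, for every `A ≥ 1`,
eventually in `n`, `e^{-G(A)} ≤ p₁(A n, n) ≤ e^{-g(A)}` (with `g(A) = (A-1)(π/3 - 1/A) - log 2`,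
`G(A) = (A+1)(π/3 + 1/A)`; Fekete sandwich both ways). [folklore] -/
theorem co_cardyOrderOne_of_kacOne : ∀ γ : ℕ → ℝ, (∀ n : ℕ, 1 ≤ n → Tendsto (fun m : ℕ ↦ -Real.log (crossingProb half m n) / (m : ℝ)) atTop (𝓝 (γ n))) → Tendsto (fun n : ℕ ↦ (n : ℝ) * γ n) atTop (𝓝 (Real.pi / 3)) → ∃ g G : ℕ → ℝ, Tendsto (fun A : ℕ ↦ g A / A) atTop (𝓝 (Real.pi / 3)) ∧ Tendsto (fun A : ℕ ↦ G A / A) atTop (𝓝 (Real.pi / 3)) ∧ ∀ A : ℕ, 1 ≤ A → ∀ᶠ n : ℕ in atTop, Real.exp (-G A) ≤ crossingProb half (A * n) n ∧ crossingProb half (A * n) n ≤ Real.exp (-g A) := by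
  intro γ hγ hK
  refine ⟨fun A ↦ ((A : ℝ) - 1) * (Real.pi / 3 - 1 / A) - Real.log 2,
    fun A ↦ ((A : ℝ) + 1) * (Real.pi / 3 + 1 / A), co1n_tendsto_g, co1n_tendsto_G, fun A hA ↦ ?_⟩
  have hApos : (0 : ℝ) < A := by exact_mod_cast hA
  have hAinv : (0 : ℝ) < 1 / A := by positivity
  have elow : ∀ᶠ n : ℕ in atTop, Real.pi / 3 - 1 / A ≤ (n : ℝ) * γ n :=
    hK.eventually_const_le (by linarith)
  have eup : ∀ᶠ n : ℕ in atTop, (n : ℝ) * γ n ≤ Real.pi / 3 + 1 / A :=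
    hK.eventually_le_const (by linarith)
  filter_upwards [eventually_ge_atTop 1, elow, eup] with n hn hnlow hnup
  exact ⟨co1n_lower hA hn (hγ n hn) hnup, co1n_upper hA hn (hγ n hn) hnlow⟩

end Summit.CriticalPhenomena.CardyFormulaZ2.Cruxes.StripClusterRates.TwoClusterRateIsStationaryGap

end
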